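import Summits.QuantumFields.YangMills.Theorems.UnitScaleTiltHalvingP1FlatCoreTopLinearKnit
import Literature.MathematicalPhysics.QuantumFieldTheory.Balaban1983to89.B8Eq142KLevelLocalGamma
import Literature.MathematicalPhysics.QuantumFieldTheory.Balaban1983to89.B7Prop4GeneralCk
import Literature.MathematicalPhysics.QuantumFieldTheory.Balaban1983to89.B9SupplySockB9P3ZdGamma
import Summits.QuantumFields.YangMills.Theorems.UnitScaleTiltHalvingHSiteTopH42Datum
import Summits.QuantumFields.YangMills.Theorems.UnitScaleTiltHalvingP1FlatCoreTopH42
import Literature.MathematicalPhysics.QuantumFieldTheory.Balaban1983to89.B8Prop6OfThm4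
import HarnessLib

/-!
# Line H (`BirthV10.stub_halvingStep`, stmt-QuantumFields-19200) — THIN ROAD γ (★★OWNER RULING g28-№11, LEAD-H WORDS 21∕24; V7-8γ LOCATE cfd2f0c2):
# ★★★ THE (1.42) CLAUSE AT THE TOP STEP IN EDITION γ — twin of ✓p645668 `P1FlatCoreTopH42` at PRINT's constraint class (box law «box ⊂ Ω_{j−1}», [B6] (2.3) ∕ (1.31)),
# levels `j < k` by lit ✓`B8Eq142KLevelLocalGamma.H42_of_inAx_γ` (top index set emptied), the top level SPLIT: the INNER top bonds by the LINEAR KNIT + ε₁-route as before,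
# the CROSSING top bonds of `□^{(k)}` (the γ class's extra members) as ONE DISPLAYED RESIDUAL `H42cross` (print's (1.29)@(k−1) mechanism; not derived here)

Cell `ym3-torus` (HUMAN RULING D-0037: YM₃ on T³ is ladder rung R3 — NOT d = 4, NOT a mass gap, NOT the Clay problem), width seat `ym-ust-20520-w3` gen 8.
`--supports stmt-QuantumFields-19200 --as helper`; THEOREMS ONLY (0 `def`, 0 `sorry`); count-neutral; nothing here claims `core′`, `hSupU`, the stub, the crux or the gap.

WHY (V7-8γ LOCATE, HOME `ym-ust-20520-w3/g8/LOCATE-V7-8-H42-TOP-GAMMA-w3g8.md`).  In edition γ the (1.59)∕(1.42) class at the member is print's `cubeLamBP′` — at the top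
level `{⟨y,τ⟩ | y ∈ □^{(k)} ∨ y + e_τ ∈ □^{(k)}}` — strictly larger than `cubeLamB … k k k` (both end-blocks in `□^{(k)}`) by the level-`k` CROSSING bonds of
`□^{(k)}`.  ✓p645668's top route (the knit identity `W = Wf ∘ π` on the comb box + ✓`P1FlatCoreTopLinearKnit` + the ε₁-smallness `htop` of
✓`HalvingHSiteTopH42Datum.htop_of_knitGauge`) needs the top identity AT BOTH END-BLOCKS, available on `□^{(k)}` only; print reaches the crossing bonds through
(1.29) at level `k − 1` on the collar (lit ✓`cubeLamBP'_hclass` alt-3, ✓`B8Eq178Averages.rbar_succ_eq_one_of_block`), a mechanism this chain does not yet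
type at the top ((M2) of the LOCATE).  THIS FILE therefore keeps ✓p645668's proof for every bond it covers and DISPLAYS the rest:
* §1 ★★★ `h42_top_of_below_and_knit_γ` — ✓`h42_top_of_below_and_knit` with (i) the γ box law `hbox : … → x ∈ Ω (j − 1)` and (1.35) `h135` under the same law,
  (ii) [3]-Prop.-4 windows ONE LEVEL LOWER `(L²α₀, L·α₂)` (lit :96's letters), (iii) levels `j < k` by ✓`H42_of_inAx_γ` READ WITH THE TOP INDEX SET EMPTIED
  (`Function.update Λs k ∅`, class family `fun m i => if m = k ∧ i < k then Λb i else ∅` — every clause at `i < k` unchanged, `i = k` vacuous), (iv) the top level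
  `j = k` SPLIT on a sub-class `ΛbIn ⊆ Λb k` (at the member: `cubeLamB … k k k`): on `ΛbIn` the linear knit VERBATIM (`hjunc hWf hAf htop hwin` over `ΛbIn`), on
  `Λb k ∖ ΛbIn` the displayed hypothesis `hcross`.
* §2 ★★ `H42_top_guarded_γ` — the GUARDED binder shape (= the `H42` input of ✓`HalvingP1FlatCoreTopSizesGamma.prop3_sizes_top_γ` at `U₀ = 1`, families
  `Λs k := Function.update Λs k ∅`, `Λb k j := Λb j`) from the knit rows `hLan hWf1 htop` over `ΛbIn` (as ✓`H42_top_guarded`) and ONE ∀(u, W, A′)-closed displayed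
  residual `H42cross` (the composers close it over `gJ` and display it as `H42topCrossL`).
HONEST SCOPE.  Wiring by name; `H42cross` is a HYPOTHESIS — print's (1.42) at the crossing top bonds, true by (1.29)@(k−1) in print, NOT derived here (A6: at the
trivial member `U = 1, u = 1, A′ = 0` its conclusion reads `‖Q_k(1,0)‖ = 0 < 2dLα₁`); nothing of Proposition 3 ∕ [4] ∕ the stub ∕ the crux is proved.

References: T. Bałaban, CMP **99** (1985) 75–102 [Balaban1985RegularSpaces] ((1.42) p.83, Prop. 3 p.87, (1.29) p.81, (1.19) p.79, (1.31) p.82, (1.35) p.82, Prop. 6 p.99);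
CMP **96** (1984) 223–250 [Balaban1984PropagatorsII] ((2.3) p.224); CMP **98** (1985) 17–51 [Balaban1985Averaging] (Prop. 4 pp.38–39); CMP **102** (1985) 277–309
[Balaban1985Variational] ((152)–(156) pp.301–302).
-/

set_option autoImplicit false

noncomputable section

open scoped BigOperators Matrix.Norms.L2Operator

namespace Summit.QuantumFields.YangMills.Theorems.P1FlatCoreTopH42Gamma

open Literature.MathematicalPhysics.QuantumFieldTheory.Balaban1983to89
open T4Continuum MatrixLog
open B15Eq112TorusCover (cover)
open B14DomainGeom (Pt)
open Node00 (coverAt)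
open B5Eq118OneStroke (iterBlockOf)
open B7Prop1Explicit (e)
open B7Prop2Explicit (unitaryUnits avgIter C0 c2')
open B7Prop1Local (InBox AgreeOn loK bondHiK)
open B7Prop3Flat (c3)
open B7Prop4Flat (C2 c4)
open B7Prop4GeneralLevels (logCovIter)
open B7LocalityGeneral (logCovIter_congr)
open B7Eq92Concrete (mgauge)
open B8Lemma1NonAbelian (mulCfg)
open B8Eq146AExpansion (iEta)
open B8Eq184Proof (cfgExp)
open B8Ineq132 (InAk)
open B8Eq140Level (SideTouches sideTouches_of_bondTouches)
open B8Eq119TwistedAxial (InAx Restr129)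
open B8Thm2LogB (blockTop)
open Summit.QuantumFields.YangMills.Theorems.Prop8Chart (expCfg)
open Summit.QuantumFields.YangMills.Theorems.Prop8ChartDoubleBar (dbarIterU)
open Summit.QuantumFields.YangMills.Theorems.P1FlatCoreTopLinearKnit (norm_logCovIter_one_le_norm_mlog_dbarIterU_of_socket)
open Summit.QuantumFields.YangMills.Theorems.P1FlatCoreTopH42 (smul_chart_cancel)

variable {P : Params} {n : Type*} [Fintype n] [DecidableEq n] [Nonempty n]

/-! ## §1 The (1.42) clause at all levels of the top step, edition γ: below the top by (1.29)∕(1.19) under print's box law, at the inner top bonds by the linear knit, the crossing top bonds displayed -/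

/-- ★★★ **THE (1.42) CLAUSE `h42` OF PROPOSITION 3 AT THE TOP STEP, `U₀ = 1`, EDITION γ** (twin of ✓`P1FlatCoreTopH42.h42_top_of_below_and_knit`: γ box law, windows at
`(L²α₀, L·α₂)`, lit ✓`H42_of_inAx_γ` below the top, the top level split `ΛbIn` ∕ displayed `hcross`) — for the final gauge-fixed triple `(u, W, A′)` of the H-line's `k`-th step:
`∀ j ≤ k, ∀ c ∈ Λb j, ‖Q_j(1, iηA′)(c)‖ < 2dLα₁`.  Levels `j < k`: ✓`B8Eq142KLevelLocalGamma.H42_of_inAx_γ` with the top index set emptied (`Function.update Λs k ∅`),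
applied to the internally masked field `𝟙_{⋃_{j ≤ k} SideTouches (Ω j)}·A′` and returned to `A′` by ✓`B7LocalityGeneral.logCovIter_congr` (`hbox`: the box of a
constraint bond lies in `Ω_{j−1}`, whose bonds are sides touching `Ω_{j−1}` as `d ≥ 2`).  Level `j = k`: on `ΛbIn` ✓`P1FlatCoreTopLinearKnit.norm_logCovIter_one_le_norm_mlog_dbarIterU_of_socket`
`+` the displayed (o)-row `‖log U̿^{(k)}(Wf)(c♭)‖ ≤ t` and the window `t + (C₂(d) + 64·60800·((d+2)L)²)·α₂² < 2dLα₁`; on `Λb k ∖ ΛbIn` the displayed residual `hcross`.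
[cite: Balaban1985RegularSpaces, (1.42) p.83, Prop. 3 p.87, (1.29) p.81, (1.19) p.79, (1.31) p.82, (1.35) p.82; Balaban1984PropagatorsII, (2.3) p.224; Balaban1985Averaging, Prop. 4 pp.38-39; Balaban1985Variational, (152)-(156) pp.301-302] -/
theorem h42_top_of_below_and_knit_γ (hd2 : 2 ≤ P.d) (hL : 2 ≤ P.L) {k : ℕ} (hk1 : 1 ≤ k) (hk : k ≤ P.m + P.K)
    {η : ℝ} (hη : 0 < η) {U' : Pt P.d → Fin P.d → (Matrix n n ℂ)ˣ}
    {α₀ α₁ α₂ : ℝ} (hα₀ : 0 < α₀) (hα₁ : 0 < α₁) (hα₂ : 0 ≤ α₂)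
    -- [3] Prop. 4's windows ONE LEVEL LOWER (edition γ, lit ✓`H42_of_inAx_γ` :96's letters): at `(L²α₀, L·α₂)`
    (hα3 : C0 P.d * ((P.L : ℝ) ^ 2 * α₀) ≤ 1 / 3) (hα4 : 4 * ((P.L : ℝ) ^ 2 * α₀) ≤ c2' P.d P.L) (h16 : 16 * ((P.L : ℝ) * α₂) ≤ 1)
    (hsmall : Real.exp (4 * (800 * ((P.d : ℝ) + 1) ^ 2 * ((P.d : ℝ) + 4)) * ((P.L : ℝ) ^ 2 * α₀)) *
      (1 + 8 * (131072 * ((P.d : ℝ) + 1) ^ 2) * ((P.L : ℝ) * α₂)) ≤ 2)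
    (hc₃ : 2 * ((P.L : ℝ) * α₂) ≤ c3 P.d P.L) (hsmall₁ : (P.d : ℝ) * P.L * α₁ ≤ 1 / 8)
    (Ω : ℕ → Set (Pt P.d)) (hΩ : ∀ j, Ω (j + 1) ⊆ Ω j)
    (Λs : ℕ → Set (Pt P.d)) (Λb : ℕ → Set (Pt P.d × Fin P.d))
    -- PRINT's box law (edition γ): the locality box of a level-`j` constraint bond lies in `Ω_{j−1}` ((1.31); level 0: `Ω₀`)
    (hbox : ∀ j, j < k → ∀ c ∈ Λb j, ∀ x, InBox (loK P.L j c.1) (bondHiK P.L j c.1 c.2) x → x ∈ Ω (j - 1))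
    (hclass : ∀ j, j < k → ∀ c ∈ Λb j,
      (c.1 ∈ Λs j ∧ c.1 + e c.2 ∈ Λs j) ∨
      (∃ j', j = j' + 1 ∧ (∀ x, (P.L : ℤ) • c.1 ≤ x → x ≤ (P.L : ℤ) • c.1 + blockTop P.L → x ∈ Λs j') ∧ c.1 + e c.2 ∈ Λs j) ∨
      (∃ j', j = j' + 1 ∧ c.1 ∈ Λs j ∧
        (∀ x, (P.L : ℤ) • (c.1 + e c.2) ≤ x → x ≤ (P.L : ℤ) • (c.1 + e c.2) + blockTop P.L → x ∈ Λs j')))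
    (h34 : InAk P.L k η α₀ Ω (mulCfg U' 1))
    (hAx : InAx P.L k (Function.update Λs k ∅) 1 (mulCfg U' 1))
    -- (1.35) on every level-`j` bond whose locality box lies in `Ω_{j−1}` (γ law)
    (h135 : ∀ j, j ≤ k → ∀ (z : Pt P.d) (μ : Fin P.d), (∀ x, InBox (loK P.L j z) (bondHiK P.L j z μ) x → x ∈ Ω (j - 1)) →
      ‖((avgIter P.L (mulCfg U' 1) j z μ : (Matrix n n ℂ)ˣ) : Matrix n n ℂ) - 1‖ ≤ α₁)
    -- the INNER top sub-class (at the member: `cubeLamB … k k k`, both end-blocks in `□^{(k)}`), where the knit reads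
    (ΛbIn : Set (Pt P.d × Fin P.d))
    {u : Pt P.d → (Matrix n n ℂ)ˣ} {W : Pt P.d → Fin P.d → (Matrix n n ℂ)ˣ} {A' : Pt P.d → Fin P.d → Matrix n n ℂ}
    (hu : ∀ x, u x ∈ unitaryUnits (Matrix n n ℂ)) (hW : mgauge 1 u W = U')
    (h129 : Restr129 P.L k (Function.update Λs k ∅) 1 u)
    (hsa : ∀ y τ, IsSelfAdjoint (A' y τ))
    (hsock : ∀ j, j ≤ k → ∀ y τ, SideTouches (Ω j) y τ →
      W y τ = cfgExp η A' y τ ∧ ‖A' y τ‖ ≤ α₂ * ((P.L : ℝ) ^ j * η)⁻¹)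
    (Af : PBond P 0 → Matrix n n ℂ) (Wf : GaugeField P 0 (Matrix n n ℂ)ˣ)
    (hjunc : ∀ c ∈ ΛbIn, AgreeOn (loK P.L k c.1) (bondHiK P.L k c.1 c.2) A' (fun w μ => Af ⟨cover P w, μ⟩))
    (hWf : ∀ c ∈ ΛbIn, ∀ b : PBond P 0,
      (iterBlockOf k b.src = (⟨coverAt P k c.1, c.2⟩ : PBond P k).src ∨ iterBlockOf k b.src = (⟨coverAt P k c.1, c.2⟩ : PBond P k).tgt) →
      (iterBlockOf k b.tgt = (⟨coverAt P k c.1, c.2⟩ : PBond P k).src ∨ iterBlockOf k b.tgt = (⟨coverAt P k c.1, c.2⟩ : PBond P k).tgt) →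
        Wf b = expCfg η Af b)
    (hAf : ∀ c ∈ ΛbIn, ∀ b : PBond P 0,
      (iterBlockOf k b.src = (⟨coverAt P k c.1, c.2⟩ : PBond P k).src ∨ iterBlockOf k b.src = (⟨coverAt P k c.1, c.2⟩ : PBond P k).tgt) →
      (iterBlockOf k b.tgt = (⟨coverAt P k c.1, c.2⟩ : PBond P k).src ∨ iterBlockOf k b.tgt = (⟨coverAt P k c.1, c.2⟩ : PBond P k).tgt) →
        ‖Af b‖ ≤ α₂ * ((P.L : ℝ) ^ k * η)⁻¹)
    (hkb : α₂ ≤ c4 P.d) (hbudget : 243200 * (((P.d + 2) * P.L : ℕ) : ℝ) ^ 2 * α₂ ≤ 1)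
    {t : ℝ} (htop : ∀ c ∈ ΛbIn, ‖mlog ((dbarIterU k Wf ⟨coverAt P k c.1, c.2⟩ : (Matrix n n ℂ)ˣ) : Matrix n n ℂ)‖ ≤ t)
    (hwin : t + (C2 P.d + 64 * 60800 * (((P.d + 2) * P.L : ℕ) : ℝ) ^ 2) * α₂ ^ 2 < 2 * (P.d : ℝ) * P.L * α₁)
    -- THE DISPLAYED RESIDUAL (edition γ): (1.42) at the CROSSING top bonds `Λb k ∖ ΛbIn` (print: (1.29)@(k−1) on the collar; not derived here)
    (hcross : ∀ c ∈ Λb k, c ∉ ΛbIn → ‖logCovIter P.L 1 (iEta η A') k c.1 c.2‖ < 2 * (P.d : ℝ) * P.L * α₁) :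
    ∀ j, j ≤ k → ∀ c ∈ Λb j, ‖logCovIter P.L 1 (iEta η A') j c.1 c.2‖ < 2 * (P.d : ℝ) * P.L * α₁ := by
  classical
  letI : CStarAlgebra (Matrix n n ℂ) := {}
  have hL1 : 1 ≤ P.L := le_trans (by norm_num) hL
  haveI : Nontrivial (Fin P.d) := Fin.nontrivial_iff_two_le.mpr hd2
  intro j hj c hc
  rcases hj.lt_or_eq with hlt | rfl
  swap
  · -- THE TOP LEVEL: the linear knit at an INNER top constraint bond `c`; the displayed residual at a CROSSING one
    by_cases hIn : c ∈ ΛbIn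
    · have h := norm_logCovIter_one_le_norm_mlog_dbarIterU_of_socket hL hk1 hk hη Af A' Wf c.1 c.2 (hjunc c hIn) (hWf c hIn)
        hα₂ (hAf c hIn) hkb hbudget
      have ht := htop c hIn
      linarith
    · exact hcross c hc hIn
  -- BELOW THE TOP: `H42_of_inAx` with the top index set emptied, on the masked field
  -- a bond of the box of a constraint bond is a side touching `Ω_j`
  have hside : ∀ {j : ℕ} {x : Pt P.d} (μ : Fin P.d), x ∈ Ω j → SideTouches (Ω j) x μ := fun {j x} μ hx => by
    obtain ⟨ν, hν⟩ := exists_ne μ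
    exact sideTouches_of_bondTouches hν (Or.inl hx)
  -- the mask and the masked field
  set M : Set (Pt P.d × Fin P.d) := {b | ∃ i, i ≤ k ∧ SideTouches (Ω i) b.1 b.2} with hM_def
  set A'' : Pt P.d → Fin P.d → Matrix n n ℂ := fun y τ => if (y, τ) ∈ M then A' y τ else 0 with hA''_def
  have hA''_of_mem : ∀ {y : Pt P.d} {τ : Fin P.d}, (y, τ) ∈ M → A'' y τ = A' y τ := fun {y τ} h => by
    simp only [hA''_def, if_pos h]
  have hsa'' : ∀ y τ, IsSelfAdjoint (A'' y τ) := by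
    intro y τ
    by_cases h : (y, τ) ∈ M
    · rw [hA''_of_mem h]; exact hsa y τ
    · have : A'' y τ = 0 := by simp only [hA''_def, if_neg h]
      rw [this]; exact IsSelfAdjoint.zero _
  have hsock'' : ∀ i, i ≤ k → ∀ y τ, SideTouches (Ω i) y τ →
      W y τ = cfgExp η A'' y τ ∧ ‖A'' y τ‖ ≤ α₂ * ((P.L : ℝ) ^ i * η)⁻¹ := by
    intro i hi y τ hs
    have hmem : (y, τ) ∈ M := ⟨i, hi, hs⟩
    obtain ⟨hWy, hAy⟩ := hsock i hi y τ hs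
    refine ⟨?_, by rw [hA''_of_mem hmem]; exact hAy⟩
    rw [hWy]
    exact B8Prop3GaugeFixedKLevel.cfgExp_congr_at η (hA''_of_mem hmem).symm
  have hA''0 : ∀ y τ, (∀ i, i ≤ k → ¬ SideTouches (Ω i) y τ) → A'' y τ = 0 := by
    intro y τ h
    have hn : (y, τ) ∉ M := fun ⟨i, hi, hs⟩ => h i hi hs
    simp only [hA''_def, if_neg hn]
  -- the standing rows of `H42_of_inAx` at `U₀ = 1` for the emptied families
  have hU₀ : ∀ (x : Pt P.d) (κ : Fin P.d), (1 : Pt P.d → Fin P.d → (Matrix n n ℂ)ˣ) x κ ∈ unitaryUnits (Matrix n n ℂ) :=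
    fun _ _ => (unitaryUnits (Matrix n n ℂ)).one_mem
  have h33 : InAk P.L k η α₀ Ω (1 : Pt P.d → Fin P.d → (Matrix n n ℂ)ˣ) := B8Prop6OfThm4.one_inAk hL1 k hη hα₀ Ω
  have hupd : ∀ {i : ℕ}, i < k → Function.update Λs k ∅ i = Λs i := fun {i} hi => Function.update_of_ne (Nat.ne_of_lt hi) _ _
  have h135' : ∀ i, i ≤ k → ∀ (z : Pt P.d) (μ : Fin P.d), (∀ x, InBox (loK P.L i z) (bondHiK P.L i z μ) x → x ∈ Ω (i - 1)) →
      ‖((avgIter P.L (mulCfg U' 1) i z μ : (Matrix n n ℂ)ˣ) : Matrix n n ℂ) -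
        ((avgIter P.L (1 : Pt P.d → Fin P.d → (Matrix n n ℂ)ˣ) i z μ : (Matrix n n ℂ)ˣ) : Matrix n n ℂ)‖ ≤ α₁ := by
    intro i hi z μ hzΩ
    have e1 : ((avgIter P.L (1 : Pt P.d → Fin P.d → (Matrix n n ℂ)ˣ) i z μ : (Matrix n n ℂ)ˣ) : Matrix n n ℂ) = 1 := by
      rw [B7Eq92Concrete.avgIter_one]; rfl
    rw [e1]; exact h135 i hi z μ hzΩ
  -- membership in the internal constraint-bond family
  have hmemb : ∀ {m i : ℕ} {c' : Pt P.d × Fin P.d},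
      c' ∈ (fun m i => if m = k ∧ i < k then Λb i else (∅ : Set (Pt P.d × Fin P.d))) m i → i < k ∧ c' ∈ Λb i := by
    intro m i c' h
    dsimp only at h
    by_cases hmi : m = k ∧ i < k
    · rw [if_pos hmi] at h; exact ⟨hmi.2, h⟩
    · rw [if_neg hmi] at h; exact False.elim ((Set.mem_empty_iff_false _).mp h)
  have H := B8Eq142KLevelLocalGamma.H42_of_inAx_γ (U₀ := 1) hd2 hη hL k hU₀ hα₀ hα₁ hα₂ hα3 hα4 h16 hsmall hc₃ hsmall₁ Ω hΩ
    (fun _ => Function.update Λs k ∅) (fun m i => if m = k ∧ i < k then Λb i else ∅) ?_ ?_ h33 h34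
    (fun m hm i hi1 him => hAx i hi1 (him.trans hm)) h135' (fun _ _ => True)
  rotate_left
  · -- boxes of the constraint bonds below the top lie in `Ω_{j−1}` (γ law)
    intro m _ i _ c' hc' x hx
    obtain ⟨hik, hc'b⟩ := hmemb hc'
    exact hbox i hik c' hc'b x hx
  · -- the bond classes below the top, read in the emptied family
    intro m _ i _ c' hc'
    obtain ⟨hik, hc'b⟩ := hmemb hc'
    rw [hupd hik]
    rcases hclass i hik c' hc'b with h1 | ⟨j', hij, hblk, h2⟩ | ⟨j', hij, h1, hblk⟩
    · exact Or.inl h1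
    · refine Or.inr (Or.inl ⟨j', hij, fun x hx1 hx2 => ?_, h2⟩)
      rw [hupd (by omega)]; exact hblk x hx1 hx2
    · refine Or.inr (Or.inr ⟨j', hij, h1, fun x hx1 hx2 => ?_⟩)
      rw [hupd (by omega)]; exact hblk x hx1 hx2
  -- the masked conclusion at `(j, c)`, returned to `A′` by locality
  have hc' : c ∈ (fun m i => if m = k ∧ i < k then Λb i else (∅ : Set (Pt P.d × Fin P.d))) k j := by
    show c ∈ (if k = k ∧ j < k then Λb j else (∅ : Set (Pt P.d × Fin P.d)))
    rw [if_pos ⟨rfl, hlt⟩]; exact hc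
  have key := H k hk1 le_rfl u W A'' hu hW h129 trivial hsa'' hsock'' hA''0 j hlt.le c hc'
  have hag : AgreeOn (loK P.L j c.1) (bondHiK P.L j c.1 c.2) (iEta η A') (iEta η A'') := by
    intro x μ hx _
    have hmem : (x, μ) ∈ M := ⟨j - 1, by omega, hside μ (hbox j hlt c hc x hx)⟩
    show ((Complex.I : ℂ) * η) • A' x μ = ((Complex.I : ℂ) * η) • A'' x μ
    rw [hA''_of_mem hmem]
  rw [logCovIter_congr P.L hL1 j c.1 c.2 (fun _ _ _ _ => rfl) hag]
  exact key

/-! ## §2 The same in the GUARDED binder shape of ✓`HalvingP1FlatCoreTopSizesGamma.prop3_sizes_top_γ` at the single level `k` -/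


/-- ★★ **(W1)γ IN THE GUARDED BINDER SHAPE** — the `H42` binder of ✓`HalvingP1FlatCoreTopSizesGamma.prop3_sizes_top_γ` read at the single level `m = k`
(edition γ: print's class under the box law «⊂ Ω_{j−1}»; twin of ✓`P1FlatCoreTopH42.H42_top_guarded` with the knit rows over `ΛbIn` and the ∀(u,W,A′)-closed residual `H42cross`), at `U₀ = 1`, for the families `Λs k := Function.update Λs k ∅`
(«(1.29) below the top»), `Λb k j := Λb j`, and ANY Landau predicate `Lan` that hands the cover pull-back identity `W = Wf ∘ π` on the comb boxes of the top
constraint bonds (`hLan`; STAGE 3 takes `Lan k W := IsLandau138W … W ∧ <that identity>`).  For every admissible `(u, W, A′)` the junction `A′ = Af ∘ π`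
with `Af := η⁻¹·i⁻¹·log Wf` is DERIVED on the comb boxes from the chart socket by `log ∘ exp = id` (✓`B8Prop3GaugeFixedKLevel.log_cfgExp_eq`,
`16α₂ ≤ 1`), and the torus rows of §1 from the displayed near-flatness `‖Wf − 1‖ ≤ r` on the reads (`r ≤ ½`, `2r ≤ α₂L⁻ᵏ`: ✓`MatrixLog.exp_mlog`,
✓`MatrixLog.norm_mlog_le_two_mul`); then §1. [cite: Balaban1985RegularSpaces, (1.42) p.83, Prop. 3 p.87, Thm 4 p.88, (1.31) p.82; Balaban1984PropagatorsII, (2.3) p.224; Balaban1985Variational, (152)-(156) pp.301-302] -/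
theorem H42_top_guarded_γ (hd2 : 2 ≤ P.d) (hL : 2 ≤ P.L) {k : ℕ} (hk1 : 1 ≤ k) (hk : k ≤ P.m + P.K)
    {η : ℝ} (hη : 0 < η) {U' : Pt P.d → Fin P.d → (Matrix n n ℂ)ˣ}
    {α₀ α₁ α₂ : ℝ} (hα₀ : 0 < α₀) (hα₁ : 0 < α₁) (hα₂ : 0 ≤ α₂)
    -- [3] Prop. 4's windows ONE LEVEL LOWER (edition γ, lit ✓`H42_of_inAx_γ` :96's letters): at `(L²α₀, L·α₂)`
    (hα3 : C0 P.d * ((P.L : ℝ) ^ 2 * α₀) ≤ 1 / 3) (hα4 : 4 * ((P.L : ℝ) ^ 2 * α₀) ≤ c2' P.d P.L) (h16 : 16 * ((P.L : ℝ) * α₂) ≤ 1)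
    (hsmall : Real.exp (4 * (800 * ((P.d : ℝ) + 1) ^ 2 * ((P.d : ℝ) + 4)) * ((P.L : ℝ) ^ 2 * α₀)) *
      (1 + 8 * (131072 * ((P.d : ℝ) + 1) ^ 2) * ((P.L : ℝ) * α₂)) ≤ 2)
    (hc₃ : 2 * ((P.L : ℝ) * α₂) ≤ c3 P.d P.L) (hsmall₁ : (P.d : ℝ) * P.L * α₁ ≤ 1 / 8)
    (Ω : ℕ → Set (Pt P.d)) (hΩ : ∀ j, Ω (j + 1) ⊆ Ω j)
    (Λs : ℕ → Set (Pt P.d)) (Λb : ℕ → Set (Pt P.d × Fin P.d))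
    -- PRINT's box law (edition γ)
    (hbox : ∀ j, j ≤ k → ∀ c ∈ Λb j, ∀ x, InBox (loK P.L j c.1) (bondHiK P.L j c.1 c.2) x → x ∈ Ω (j - 1))
    (hclass : ∀ j, j < k → ∀ c ∈ Λb j,
      (c.1 ∈ Λs j ∧ c.1 + e c.2 ∈ Λs j) ∨
      (∃ j', j = j' + 1 ∧ (∀ x, (P.L : ℤ) • c.1 ≤ x → x ≤ (P.L : ℤ) • c.1 + blockTop P.L → x ∈ Λs j') ∧ c.1 + e c.2 ∈ Λs j) ∨
      (∃ j', j = j' + 1 ∧ c.1 ∈ Λs j ∧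
        (∀ x, (P.L : ℤ) • (c.1 + e c.2) ≤ x → x ≤ (P.L : ℤ) • (c.1 + e c.2) + blockTop P.L → x ∈ Λs j')))
    (h34 : InAk P.L k η α₀ Ω (mulCfg U' 1))
    (hAx : InAx P.L k (Function.update Λs k ∅) 1 (mulCfg U' 1))
    -- (1.35) on every level-`j` bond whose locality box lies in `Ω_{j−1}` (γ law)
    (h135 : ∀ j, j ≤ k → ∀ (z : Pt P.d) (μ : Fin P.d), (∀ x, InBox (loK P.L j z) (bondHiK P.L j z μ) x → x ∈ Ω (j - 1)) →
      ‖((avgIter P.L (mulCfg U' 1) j z μ : (Matrix n n ℂ)ˣ) : Matrix n n ℂ) - 1‖ ≤ α₁)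
    (Lan : ℕ → (Pt P.d → Fin P.d → (Matrix n n ℂ)ˣ) → Prop) (Wf : GaugeField P 0 (Matrix n n ℂ)ˣ)
    -- the INNER top sub-class where the knit reads (at the member `cubeLamB … k k k ⊆ cubeLamBP′ … k k k`)
    (ΛbIn : Set (Pt P.d × Fin P.d)) (hIn : ΛbIn ⊆ Λb k)
    (hLan : ∀ W : Pt P.d → Fin P.d → (Matrix n n ℂ)ˣ, Lan k W → ∀ c ∈ ΛbIn, ∀ (y : Pt P.d) (τ : Fin P.d),
      InBox (loK P.L k c.1) (bondHiK P.L k c.1 c.2) y → InBox (loK P.L k c.1) (bondHiK P.L k c.1 c.2) (y + e τ) →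
        W y τ = Wf ⟨cover P y, τ⟩)
    {r : ℝ} (hr : r ≤ 1 / 2) (hr2 : 2 * r ≤ α₂ * ((P.L : ℝ) ^ k)⁻¹)
    (hWf1 : ∀ c ∈ ΛbIn, ∀ b : PBond P 0,
      (iterBlockOf k b.src = (⟨coverAt P k c.1, c.2⟩ : PBond P k).src ∨ iterBlockOf k b.src = (⟨coverAt P k c.1, c.2⟩ : PBond P k).tgt) →
      (iterBlockOf k b.tgt = (⟨coverAt P k c.1, c.2⟩ : PBond P k).src ∨ iterBlockOf k b.tgt = (⟨coverAt P k c.1, c.2⟩ : PBond P k).tgt) →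
        ‖((Wf b : (Matrix n n ℂ)ˣ) : Matrix n n ℂ) - 1‖ ≤ r)
    (hkb : α₂ ≤ c4 P.d) (hbudget : 243200 * (((P.d + 2) * P.L : ℕ) : ℝ) ^ 2 * α₂ ≤ 1)
    {t : ℝ} (htop : ∀ c ∈ ΛbIn, ‖mlog ((dbarIterU k Wf ⟨coverAt P k c.1, c.2⟩ : (Matrix n n ℂ)ˣ) : Matrix n n ℂ)‖ ≤ t)
    (hwin : t + (C2 P.d + 64 * 60800 * (((P.d + 2) * P.L : ℕ) : ℝ) ^ 2) * α₂ ^ 2 < 2 * (P.d : ℝ) * P.L * α₁)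
    -- THE DISPLAYED RESIDUAL (edition γ), ∀(u, W, A′)-CLOSED: (1.42) at the CROSSING top bonds `Λb k ∖ ΛbIn`
    (H42cross : ∀ (u : Pt P.d → (Matrix n n ℂ)ˣ) (W : Pt P.d → Fin P.d → (Matrix n n ℂ)ˣ) (A' : Pt P.d → Fin P.d → Matrix n n ℂ),
      (∀ x, u x ∈ unitaryUnits (Matrix n n ℂ)) → mgauge 1 u W = U' → Restr129 P.L k (Function.update Λs k ∅) 1 u → Lan k W →
      (∀ y τ, IsSelfAdjoint (A' y τ)) →
      (∀ j, j ≤ k → ∀ y τ, SideTouches (Ω j) y τ →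
        W y τ = cfgExp η A' y τ ∧ ‖A' y τ‖ ≤ α₂ * ((P.L : ℝ) ^ j * η)⁻¹) →
      (∀ y τ, (∀ j, j ≤ k → ¬ SideTouches (Ω j) y τ) → A' y τ = 0) →
      ∀ c ∈ Λb k, c ∉ ΛbIn → ‖logCovIter P.L 1 (iEta η A') k c.1 c.2‖ < 2 * (P.d : ℝ) * P.L * α₁) :
    ∀ (u : Pt P.d → (Matrix n n ℂ)ˣ) (W : Pt P.d → Fin P.d → (Matrix n n ℂ)ˣ) (A' : Pt P.d → Fin P.d → Matrix n n ℂ),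
      (∀ x, u x ∈ unitaryUnits (Matrix n n ℂ)) → mgauge 1 u W = U' → Restr129 P.L k (Function.update Λs k ∅) 1 u → Lan k W →
      (∀ y τ, IsSelfAdjoint (A' y τ)) →
      (∀ j, j ≤ k → ∀ y τ, SideTouches (Ω j) y τ →
        W y τ = cfgExp η A' y τ ∧ ‖A' y τ‖ ≤ α₂ * ((P.L : ℝ) ^ j * η)⁻¹) →
      (∀ y τ, (∀ j, j ≤ k → ¬ SideTouches (Ω j) y τ) → A' y τ = 0) →
      ∀ j, j ≤ k → ∀ c ∈ Λb j, ‖logCovIter P.L 1 (iEta η A') j c.1 c.2‖ < 2 * (P.d : ℝ) * P.L * α₁ := by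
  intro u W A' hu hW h129 hLanW hsa hsock hA0 j hj c hc
  letI : CStarAlgebra (Matrix n n ℂ) := {}
  haveI : Nontrivial (Fin P.d) := Fin.nontrivial_iff_two_le.mpr hd2
  have hL1 : (1 : ℝ) ≤ P.L := by exact_mod_cast P.L_pos
  have hLk : (1 : ℝ) ≤ (P.L : ℝ) ^ k := one_le_pow₀ hL1
  have hLk0 : (0 : ℝ) < (P.L : ℝ) ^ k := by positivity
  -- the torus exponent field `Af := η⁻¹·i⁻¹·log Wf`
  set Af : PBond P 0 → Matrix n n ℂ := fun b => η⁻¹ • ((Complex.I⁻¹ : ℂ) • mlog ((Wf b : (Matrix n n ℂ)ˣ) : Matrix n n ℂ)) with hAf_def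
  -- junction on the comb boxes, by `log ∘ exp = id`
  have hLk1 : (1 : ℝ) ≤ (P.L : ℝ) ^ (k - 1) := one_le_pow₀ hL1
  have hjunc : ∀ c ∈ ΛbIn, AgreeOn (loK P.L k c.1) (bondHiK P.L k c.1 c.2) A' (fun w μ => Af ⟨cover P w, μ⟩) := by
    intro c hc y τ hy hyτ
    have hyΩ : y ∈ Ω (k - 1) := hbox k le_rfl c (hIn hc) y hy
    obtain ⟨ν, hν⟩ := exists_ne τ
    have hs : SideTouches (Ω (k - 1)) y τ := sideTouches_of_bondTouches hν (Or.inl hyΩ)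
    obtain ⟨hWy, hAy⟩ := hsock (k - 1) (Nat.sub_le k 1) y τ hs
    have hA2 : ‖A' y τ‖ ≤ α₂ * η⁻¹ := by
      calc ‖A' y τ‖ ≤ α₂ * ((P.L : ℝ) ^ (k - 1) * η)⁻¹ := hAy
        _ = α₂ * η⁻¹ * ((P.L : ℝ) ^ (k - 1))⁻¹ := by rw [mul_inv]; ring
        _ ≤ α₂ * η⁻¹ * 1 := by
            apply mul_le_mul_of_nonneg_left (inv_le_one_of_one_le₀ hLk1) (by positivity)
        _ = α₂ * η⁻¹ := mul_one _
    have h16' : 16 * α₂ ≤ 1 := by nlinarith [mul_nonneg (sub_nonneg.2 hL1) hα₂]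
    have hlog := B8Prop3GaugeFixedKLevel.log_cfgExp_eq (t := α₂) hη hA2 (by linarith)
    show A' y τ = η⁻¹ • ((Complex.I⁻¹ : ℂ) • mlog ((Wf ⟨cover P y, τ⟩ : (Matrix n n ℂ)ˣ) : Matrix n n ℂ))
    rw [← hLan W hLanW c hc y τ hy hyτ, hWy]
    exact hlog.symm
  -- the torus rows on the reads, from the near-flatness of `Wf`
  have hWf : ∀ c ∈ ΛbIn, ∀ b : PBond P 0,
      (iterBlockOf k b.src = (⟨coverAt P k c.1, c.2⟩ : PBond P k).src ∨ iterBlockOf k b.src = (⟨coverAt P k c.1, c.2⟩ : PBond P k).tgt) →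
      (iterBlockOf k b.tgt = (⟨coverAt P k c.1, c.2⟩ : PBond P k).src ∨ iterBlockOf k b.tgt = (⟨coverAt P k c.1, c.2⟩ : PBond P k).tgt) →
        Wf b = expCfg η Af b := by
    intro c hc b hbs hbt
    have h1 : ‖((Wf b : (Matrix n n ℂ)ˣ) : Matrix n n ℂ) - 1‖ < 1 := (hWf1 c hc b hbs hbt).trans_lt (by linarith)
    apply Units.ext
    rw [Prop8Chart.coe_expCfg, hAf_def]
    dsimp only
    rw [smul_chart_cancel hη.ne', exp_mlog h1]
  have hAf : ∀ c ∈ ΛbIn, ∀ b : PBond P 0,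
      (iterBlockOf k b.src = (⟨coverAt P k c.1, c.2⟩ : PBond P k).src ∨ iterBlockOf k b.src = (⟨coverAt P k c.1, c.2⟩ : PBond P k).tgt) →
      (iterBlockOf k b.tgt = (⟨coverAt P k c.1, c.2⟩ : PBond P k).src ∨ iterBlockOf k b.tgt = (⟨coverAt P k c.1, c.2⟩ : PBond P k).tgt) →
        ‖Af b‖ ≤ α₂ * ((P.L : ℝ) ^ k * η)⁻¹ := by
    intro c hc b hbs hbt
    have h1 := hWf1 c hc b hbs hbt
    have h2 := norm_mlog_le_two_mul (h1.trans hr)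
    rw [hAf_def]
    dsimp only
    rw [norm_smul, norm_smul, norm_inv, norm_inv, Complex.norm_I, inv_one, one_mul, Real.norm_eq_abs, abs_of_pos hη]
    calc η⁻¹ * ‖mlog ((Wf b : (Matrix n n ℂ)ˣ) : Matrix n n ℂ)‖ ≤ η⁻¹ * (2 * r) := by
          apply mul_le_mul_of_nonneg_left (h2.trans (by linarith)) (inv_nonneg.mpr hη.le)
      _ ≤ η⁻¹ * (α₂ * ((P.L : ℝ) ^ k)⁻¹) := mul_le_mul_of_nonneg_left hr2 (inv_nonneg.mpr hη.le)
      _ = α₂ * ((P.L : ℝ) ^ k * η)⁻¹ := by rw [mul_inv]; ring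
  exact h42_top_of_below_and_knit_γ hd2 hL hk1 hk hη hα₀ hα₁ hα₂ hα3 hα4 h16 hsmall hc₃ hsmall₁ Ω hΩ Λs Λb (fun j hj => hbox j hj.le)
    hclass h34 hAx h135 ΛbIn hu hW h129 hsa hsock Af Wf hjunc hWf hAf hkb hbudget htop hwin
    (H42cross u W A' hu hW h129 hLanW hsa hsock hA0) j hj c hc

/-! ## §3 A6 (LEAD-H WORD 17): the displayed residual at the trivial datum -/

omit [Nonempty n] in
/-- **A6 WITNESS FOR THE DISPLAYED RESIDUAL `hcross` ∕ `H42cross`**: at the trivial datum `A′ = 0` (the member `U = 1, gJ = 1, u₁ = 1, λ′ = 0`) its conclusion holds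
outright — `Q_k(1, iη·0) = 0` (lit ✓`B7Prop4GeneralCk.logCovIter_zero_field`) and `0 < 2dLα₁`.  So the residual row is not vacuous by shape.
[cite: Balaban1985Averaging, p.36 (after (121)); Balaban1985RegularSpaces, (1.42) p.83] -/
theorem hcross_trivial_datum (hd : 1 ≤ P.d) (η : ℝ) {α₁ : ℝ} (hα₁ : 0 < α₁) (k : ℕ) (c : Pt P.d × Fin P.d) :
    ‖logCovIter P.L 1 (iEta η (0 : Pt P.d → Fin P.d → Matrix n n ℂ)) k c.1 c.2‖ < 2 * (P.d : ℝ) * P.L * α₁ := by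
  have h0 : iEta η (0 : Pt P.d → Fin P.d → Matrix n n ℂ) = 0 := by
    funext y κ; simp [iEta]
  have hz := B7Prop4GeneralCk.logCovIter_zero_field P.L (1 : Pt P.d → Fin P.d → (Matrix n n ℂ)ˣ) k
  rw [h0, hz, Pi.zero_apply, Pi.zero_apply, norm_zero]
  have hdr : (0 : ℝ) < P.d := by exact_mod_cast hd
  have hLr : (0 : ℝ) < P.L := by exact_mod_cast P.L_pos
  positivity

/-! ## §4 The member's inner top class lies in print's top class -/

omit [Fintype n] [DecidableEq n] [Nonempty n] in
/-- **`hIn` AT THE MEMBER**: every top constraint bond of the inner class `cubeLamB … k k k` (both end-blocks in `□^{(k)}`, ✓`HalvingHSiteTopH42Datum.ends_mem_cubeLamS_top`)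
belongs to print's top class `cubeLamBP′ … k k k` (`k ≥ 1`: an end-point in `□^{(k)}`, lit ✓`B9SupplySockB9P3ZdGamma.cubeLamBP'_of_ne_zero` ∕
✓`B8Ineq159FlatCubeMemberPrinted.mem_cubeLamBP_iff`). [cite: Balaban1985RegularSpaces, (1.31) p.82, (1.131) p.99; Balaban1984PropagatorsII, (2.3) p.224] -/
theorem cubeLamB_top_subset_cubeLamBP' {d L : ℕ} (hL : 1 ≤ L) (a : B7Prop1Explicit.Site d) (M' ρ' : ℕ) {k : ℕ} (hk : 1 ≤ k) :
    B8CubeMemberZd.cubeLamB L a M' ρ' k k k ⊆ B9SupplySockB9P3ZdGamma.cubeLamBP' L a M' ρ' k k k := by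
  intro c hc
  have h1 := (HalvingHSiteTopH42Datum.ends_mem_cubeLamS_top hL a M' ρ' k hc).1
  rw [B8CubeMemberZd.cubeLamS_self] at h1
  rw [B9SupplySockB9P3ZdGamma.cubeLamBP'_of_ne_zero _ _ _ _ _ _ (by omega : k ≠ 0), B8Ineq159FlatCubeMemberPrinted.mem_cubeLamBP_iff]
  exact ⟨le_rfl, Or.inl h1, fun h => absurd h (lt_irrefl k)⟩

end Summit.QuantumFields.YangMills.Theorems.P1FlatCoreTopH42Gamma

end
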